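import Summits.BirchSwinnertonDyer.Rank1Residual.X11b.Three.KolyvaginShaThreeDischarged
import Summits.BirchSwinnertonDyer.Rank1Residual.X11b.Three.KolyvaginShaFiniteThreeClass
import Summits.BirchSwinnertonDyer.Rank1Residual.X11b.Three.KolyvaginHexcIdle
import Literature.NumberTheory.EllipticCurves.GrossLMS1991.HeegnerEulerSystemCongruence
import HarnessLib

/-!
# `Ш(E/K)[3^∞]` on the class X11b @ 3 ∩ (KN₃)/ℚ modulo ONE NAMED published fact —
# Gross 1991 Prop. 3.7 (2) BY NAME, all six of its standing hypotheses DISCHARGED on the class: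
# finite, killed by `3^{ord_3 [E(K) : ℤ y_K]}`, trivial when `3 ∤ y_K`

Cell `b2b-bsdres`, team x11b3 (N8/O2 = X11b @ 3); seat x11b3-p2 GEN 53 (unit claimed D-0075 →
BSD:K2/P4 «Kolyvagin-in-kernel»).  Summit-side THEOREM-ONLY file (no definition, no named fact,
no `sorry`); `K : Type`; the literal prime `3`.

HONEST FRAMING (cell `b2b-bsdres`, run/shared/lean/b2b/bsd-rank1-residual/, verbatim in every
file): the goal of the cell is to DELETE the COMBINATION-SHAPED residual classes of the
Birch–Swinnerton-Dyer formula for ALL analytic-rank `≤ 1` elliptic curves over `ℚ` — "full BSD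
formula for every rank `≤ 1` curve in class `C`" assembled STRICTLY from published theorems — so
that the rank-`≤ 1` remainder becomes exactly the CONSTRUCTION-SHAPED classes, which are TYPED
(missing-input `Prop`s), NOT attempted.  This is not "finishing BSD".  Nothing here is booked; no
mark / label / count / tier moves; X11b @ 3 = O2/B10 stays OPEN / CONSTRUCTION-SHAPED (Kolyvagin
bounds `Ш` relative to the Heegner index; it is not `BSD₃`).

WHAT THIS FILE DOES (b2b-bsdres REFEREE 2 GEN 192 nit n202, second half; lit GEN 154 P.S.,
HOME/INBOX 2026-08-27T12:26:08Z).  The four K-side ENDs of `X11b/Three/KolyvaginShaThreeDischarged`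
(x11b3-p2 GEN 52) on the class X11b @ 3 ∩ (KN₃)/ℚ carry EXACTLY ONE inline cite-only binder `hγ`
— Gross 1991 Prop. 3.7 (2) at `p = 3`.  That proposition is now the NAMED, `[cite:]`-tagged
Literature fact `GrossLMS1991.prop37_2_reductionCongruence N W K p` (lit GEN 154, p530891, §E E622),
stated AS PRINTED, i.e. under Gross's six standing hypotheses: `E` without CM, `d_K ∉ {−3, −4}`,
`p` prime, `p ≠ 2`, `ρ̄_{E,p}` onto, `N = N_E`.  ON THE CLASS AT `p = 3` ALL SIX ARE TREE THEOREMS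
(§0, `prop37_endBinder_three_of_classX11b`): `mult(3)` ⟹ `¬ CM` (`j ∉ ℤ`;
`WeierstrassCurve.not_hasMultiplicativeReductionAtPrime_of_hasCM`); `3 ∣ N_E` and the Heegner
hypothesis ⟹ `d_K ∉ {−3, −4}` (`Three.KolyvaginHexc.discr_ne_of_satisfiesHeegnerHypothesis_of_three_dvd`:
`3` ramifies in `ℚ(√−3)`, is inert in `ℚ(i)`); `3` is an odd prime; (KN₃) at the multiplicative
place `3` (`3 ∤ ord_3 Δ_min`) ⟹ `ρ̄_{E,3}` onto (`Three.surj_three_of_classX11b_of_kodairaNeron_rat`,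
Serre 1972 Prop. 15 via `ClassX11b.surj_of_not_dvd`); `N = N_E` is the END's `hN`.  So on the
class the 30-line binder `hγ` is replaced by the ONE-LINE binder
`(hγ : prop37_2_reductionCongruence N W K 3)` with NO other change: every other binder and the
conclusion VERBATIM, proof = the parent END applied to §0.  Net effect: for every `(E, 3)` in
ClassX11b W 3 ∩ (KN₃)/ℚ at `N = N_E` and every imaginary quadratic Heegner `K` with a non-torsion
Heegner point, `Ш(E/K)[3^∞]` finite / `3^{m}`-torsion for `3^{m+1} ∤ y_K` / killed by
`3^{ord_3 [E(K):ℤ y_K]}` / zero when `3 ∤ y_K` are theorems CONDITIONAL ON ONE NAMED PUBLISHED FACT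
and nothing inline.  The fact is NOT discharged (size XL; lit GEN 154); its image-free sibling
`prop37_2_frobeniusCongruence` (Nekovář 2007; p534286, §E E659) implies it
(`prop37_2_reductionCongruence_of_frobeniusCongruence`) — ONE debt.  The ℚ-side / class-level forms
are `Three/KolyvaginShaThreeRatOfProp37`; the ORDER forms `Three/KolyvaginShaOrderThreeOfProp37`.

## What is proved (namespace `Summit.BirchSwinnertonDyer.Rank1Residual.X11b.Three.KolyvaginDischarged`)

* §0 `prop37_endBinder_three_of_classX11b` — on ClassX11b W 3 ∩ (KN₃ at mult. places)/ℚ at `N = N_E`,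
  the named fact at `p = 3` yields the END binder `hγ` (its six standing hypotheses discharged).
* `sha_primary_finite_three_of_classX11b_of_kodairaNeron_rat_of_prop37` — `Ш(E/K)[3^∞]` finite.
* `pow_smul_sha_three_primary_eq_zero_of_classX11b_of_kodairaNeron_rat_of_prop37` —
  `3^{m+1} ∤ y_K ⟹ 3^{m} · Ш(E/K)[3^∞] = 0`.
* `pow_smul_sha_three_primary_eq_zero_of_classX11b_of_kodairaNeron_rat_index_of_prop37` —
  `3^{ord_3 [E(K) : ℤ y_K]} · Ш(E/K)[3^∞] = 0`.
* `sha_three_primary_eq_zero_of_classX11b_of_kodairaNeron_rat_of_not_dvd_of_prop37` —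
  `3 ∤ y_K ⟹ Ш(E/K)[3^∞] = 0`.
Each modulo EXACTLY the named fact `prop37_2_reductionCongruence N W K 3` + `hN` + (KN₃)/ℚ.

## References

* [GrossLMS1991] B. H. Gross, *Kolyvagin's work on modular elliptic curves*, LMS LNS 153 (1991),
  §1 (p. 235: `D ≠ 3, 4`), §2 (p. 237: no CM; `p` odd, `GL_2(ℤ/p)` image), Thm. 1.3 (2),
  Prop. 2.1 (2), §3 Prop. 3.7 (2) (p. 240), Prop. 5.3, §10.
* [McCallumLMS1991] W. G. McCallum, *Kolyvagin's work on Shafarevich–Tate groups*, same volume,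
  §1 Theorem (Kolyvagin), Lemma 5.1 (p. 303), §5.
* [Serre1972] J.-P. Serre, Invent. Math. 15 (1972), §2.4 Prop. 15.  [SilvermanATAEC1994] Thm.
  II.6.4, proof of Thm. II.10.5.  [SilvermanAEC2009] Thm. VII.6.1.  [Darmon2004] Thm. 3.6, 3.7.
* [Nekovar2007] J. Nekovář, LMS LNS 320 (2007), Prop. 4.9, 4.13 (ii) (the image-free sibling).

presearch: `lean search 'of_prop37'` → none; `lean search 'prop37_2_reductionCongruence'` → the
fact file + its image-free sibling (0 Summits consumers at `p = 3` before this file); parents and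
dischargers = the tree theorems named above; [corpus:book:editornd-l-functions-arithmetic p0217
L19–L22 (Prop. 3.7), p0212 L16 (`D ≠ 3, 4`), p0214 L5–L9 (no CM, `p` odd surjective)]; nothing
minted.
-/

noncomputable section

open scoped Classical
open WeierstrassCurve Field NumberField IsDedekindDomain
open Literature.NumberTheory.EllipticCurves Literature.NumberTheory.GaloisRepresentations
open Literature.NumberTheory.EllipticCurves.Rank1Residual
open Literature.NumberTheory.EllipticCurves.RingClassField
open Literature.NumberTheory.EllipticCurves.ModularForms
open Literature.NumberTheory.DiophantineGeometry Literature.NumberTheory.DiophantineGeometry.TateAlgorithm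
open Literature.NumberTheory.EllipticCurves.GrossLMS1991 (prop37_2_reductionCongruence)

namespace Summit.BirchSwinnertonDyer.Rank1Residual.X11b.Three.KolyvaginDischarged

-- `K : Type`: the tree's ring-class class field theory is universe `0`.
variable {K : Type} [Field K] [NumberField K] {N : ℕ} {W : WeierstrassCurve ℚ}

/-! ### §0 On the class X11b @ 3 the six standing hypotheses of Gross Prop. 3.7 (2) are theorems -/

/-- **On ClassX11b W 3 ∩ (KN₃)/ℚ at `N = N_E`, the NAMED fact Gross 1991 Prop. 3.7 (2) at `p = 3`
yields the X11b END binder `hγ`** — its six standing hypotheses being discharged on the class: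
`¬ CM` from `mult(3)` (`not_hasMultiplicativeReductionAtPrime_of_hasCM`, Silverman ATAEC II.6.4);
`d_K ∉ {−3, −4}` from `3 ∣ N_E` (bad reduction at `3`, `dvd_conductorNorm_iff_not_hasGoodReductionAtPrime`)
and the Heegner hypothesis (`Three.KolyvaginHexc.discr_ne_of_satisfiesHeegnerHypothesis_of_three_dvd`);
`3` an odd prime; `ρ̄_{E,3}` onto from (KN₃) at the multiplicative places
(`Three.surj_three_of_classX11b_of_kodairaNeron_rat`, Serre 1972 Prop. 15); `N = N_E` = `hN`.
The conclusion is the `p := 3` instance of the inline binder `hγ` of the GEN 52 ENDs, character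
for character.  Plumbing; nothing booked; no mark.
[cite: GrossLMS1991, §3 Prop. 3.7 (2) (p. 240), §1 (p. 235), §2 (p. 237)] [cite: Serre1972, §2.4 Prop. 15]
[cite: SilvermanATAEC1994, Thm. II.6.4 and proof of Thm. II.10.5 (PDF p. 172)] -/
theorem prop37_endBinder_three_of_classX11b [NeZero N] [W.IsGloballyMinimal] (hW : ClassX11b W 3)
    (hN : ∀ [W.IsElliptic], N = W.conductorNorm ℤ)
    (hKN3m : ∀ [W.IsElliptic] (v : HeightOneSpectrum (𝓞 ℚ)),
      W.HasMultiplicativeReductionAt v → ¬ 3 ∣ W.ordMinimalDiscriminant v)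
    (hγ : prop37_2_reductionCongruence N W K 3) :
    ∀ [W.IsElliptic] (_hK : IsImaginaryQuadratic K) (_hH : SatisfiesHeegnerHypothesis N K)
      (Dt : ModularParametrizationData W N) (β : ℤ) (ι : K →+* ℂ) {M : ℕ}
      (_hM : 1 ≤ M) {n : ℕ} (_hn : Squarefree n)
      (_hKol : ∀ q ∈ n.primeFactors, IsKolyvaginPrime N W K 3 q ∧ FrobEqFrobInfty W K (3 ^ M) q)
      (d : (m : ℕ) → m ∣ n → KolyvaginHeegnerData Dt β ι m)
      (m : ℕ) (hm : m ∣ n) (ℓ : ℕ) (hℓ : ℓ ∈ m.primeFactors) [Fact ℓ.Prime]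
      (hΔ : ¬ (ℓ : ℤ) ∣ minimalDiscriminantInt W) (φ₀ : absoluteGaloisGroup (ZMod ℓ)),
      (∀ x : AlgebraicClosure (ZMod ℓ), φ₀ • x = x ^ ℓ) →
      ∀ (hle : ringClassField K ι (m / ℓ) ≤ ringClassField K ι m)
        (γ : ringClassField K ι m ≃ₐ[ℚ] ringClassField K ι m), γ ∈ ringClassGal ι m →
        geomReduction hΔ ((RatClosure.pointsEquiv (K := K) W).symm
            ((d m hm).toGeomPoints (pointGalHom W (ringClassField K ι m) γ (d m hm).y))) =
          φ₀ • geomReduction hΔ ((RatClosure.pointsEquiv (K := K) W).symm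
            ((d m hm).toGeomPoints (pointGalHom W (ringClassField K ι m) γ
              (WeierstrassCurve.Affine.Point.map (W' := W)
                ((RingClassField.inclusion ι hle).restrictScalars ℚ)
                (d (m / ℓ)
                  ((Nat.div_dvd_of_dvd (Nat.dvd_of_mem_primeFactors hℓ)).trans hm)).y)))) := by
  intro _ hK hH Dt β ι M hM n hn hKol d m hm ℓ hℓ _ hΔ φ₀ hφ₀ hle γ hγm
  have hmult : W.HasMultiplicativeReductionAtPrime 3 := hW.2.2.1
  have hE : ¬ W.HasCM := fun hCM ↦ W.not_hasMultiplicativeReductionAtPrime_of_hasCM hCM 3 hmult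
  have h3 : 3 ∣ N := by
    rw [hN]
    exact (W.dvd_conductorNorm_iff_not_hasGoodReductionAtPrime 3).mpr
      (not_hasGoodReductionAtPrime_of_hasMultiplicativeReductionAtPrime 3 hmult)
  exact hγ hE (Three.KolyvaginHexc.discr_ne_of_satisfiesHeegnerHypothesis_of_three_dvd hK.1 hH h3)
    Nat.prime_three (by decide) (Three.surj_three_of_classX11b_of_kodairaNeron_rat hW hKN3m) hN hK
    hH Dt β ι hM hn hKol d m hm ℓ hℓ hΔ φ₀ hφ₀ hle γ hγm

/-! ### The four K-side ENDs with `hγ` taken BY NAME -/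

/-- **On the class X11b @ 3 ∩ (KN₃)/ℚ, `Ш(E/K)[3^∞]` is finite — modulo the NAMED fact
`GrossLMS1991.prop37_2_reductionCongruence N W K 3`, no inline cite-only input, NO image
hypothesis.**  The tree END `sha_primary_finite_three_of_classX11b_of_kodairaNeron_rat`
(`X11b/Three/KolyvaginShaThreeDischarged`) with its inline binder `hγ` SUPPLIED by §0; every other
binder and the conclusion VERBATIM.  For `(E, 3) ∈ ClassX11b W 3` at `N = N_E` (`hN`), (KN₃)/ℚ
(`hKN3m`, `hKN3a`), any `K : Type` imaginary quadratic with the Heegner hypothesis and a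
non-torsion Heegner point `P`: `{c ∈ Ш(E/K) | 3^j c = 0}` is finite.  CONDITIONAL on EXACTLY the
named fact {`hγ`} at `3` (PUBLISHED, NOT discharged) + `hN` + (KN₃)/ℚ; nothing booked; no mark /
count / tier moves. [cite: McCallumLMS1991, §1 Theorem (Kolyvagin)] [cite: GrossLMS1991, Thm. 1.3 (2), §3 Prop. 3.7 (2) (p. 240)]
[cite: Serre1972, §2.4 Prop. 15] -/
theorem sha_primary_finite_three_of_classX11b_of_kodairaNeron_rat_of_prop37 [NeZero N]
    [W.IsGloballyMinimal] (hW : ClassX11b W 3) (hN : ∀ [W.IsElliptic], N = W.conductorNorm ℤ)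
    (hKN3m : ∀ [W.IsElliptic] (v : HeightOneSpectrum (𝓞 ℚ)),
      W.HasMultiplicativeReductionAt v → ¬ 3 ∣ W.ordMinimalDiscriminant v)
    (hKN3a : ∀ [W.IsElliptic] (v : HeightOneSpectrum (𝓞 ℚ)), W.HasAdditiveReductionAt v →
      W.kodairaSymbolAt v ≠ KodairaSymbol.IV ∧ W.kodairaSymbolAt v ≠ KodairaSymbol.IVstar)
    (hγ : prop37_2_reductionCongruence N W K 3) :
    ∀ [W.IsElliptic] (_hK : IsImaginaryQuadratic K) (_hH : SatisfiesHeegnerHypothesis N K)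
      {P : (W.baseChange K).toAffine.Point} (_hP : IsHeegnerPoint N W K P)
      (_hnt : ¬ IsOfFinAddOrder P),
      Set.Finite {c : (W.baseChange K).sha | ∃ j : ℕ, 3 ^ j • c = 0} :=
  sha_primary_finite_three_of_classX11b_of_kodairaNeron_rat hW hN hKN3m hKN3a
    (prop37_endBinder_three_of_classX11b hW hN hKN3m hγ)

/-- **On the class X11b @ 3 ∩ (KN₃)/ℚ, `3^{m} · Ш(E/K)[3^∞] = 0` for every `m` with `3^{m+1} ∤ y_K`
— modulo the NAMED fact `GrossLMS1991.prop37_2_reductionCongruence N W K 3`** (Kolyvagin's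
annihilator; McCallum §1 Theorem / §5 with Lemma 5.1).  The tree END
`pow_smul_sha_three_primary_eq_zero_of_classX11b_of_kodairaNeron_rat`
(`X11b/Three/KolyvaginShaThreeDischarged`) with `hγ` SUPPLIED by §0; binders/conclusion otherwise
VERBATIM.  CONDITIONAL on EXACTLY the named fact {`hγ`} at `3` + `hN` + (KN₃)/ℚ; nothing booked;
no mark. [cite: McCallumLMS1991, §1 Theorem (Kolyvagin), Lemma 5.1] [cite: GrossLMS1991, Thm. 1.3 (2), §3 Prop. 3.7 (2) (p. 240), §10] -/
theorem pow_smul_sha_three_primary_eq_zero_of_classX11b_of_kodairaNeron_rat_of_prop37 [NeZero N]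
    [W.IsGloballyMinimal] (hW : ClassX11b W 3) (hN : ∀ [W.IsElliptic], N = W.conductorNorm ℤ)
    (hKN3m : ∀ [W.IsElliptic] (v : HeightOneSpectrum (𝓞 ℚ)),
      W.HasMultiplicativeReductionAt v → ¬ 3 ∣ W.ordMinimalDiscriminant v)
    (hKN3a : ∀ [W.IsElliptic] (v : HeightOneSpectrum (𝓞 ℚ)), W.HasAdditiveReductionAt v →
      W.kodairaSymbolAt v ≠ KodairaSymbol.IV ∧ W.kodairaSymbolAt v ≠ KodairaSymbol.IVstar)
    (hγ : prop37_2_reductionCongruence N W K 3) :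
    ∀ [W.IsElliptic] (_hK : IsImaginaryQuadratic K) (_hH : SatisfiesHeegnerHypothesis N K)
      {P : (W.baseChange K).toAffine.Point} (_hP : IsHeegnerPoint N W K P)
      (_hnt : ¬ IsOfFinAddOrder P) {m : ℕ}
      (_hm : ∀ Q : (W.baseChange K).toAffine.Point, 3 ^ (m + 1) • Q ≠ P) (c : (W.baseChange K).sha),
      (∃ j : ℕ, 3 ^ j • c = 0) → 3 ^ m • c = 0 :=
  pow_smul_sha_three_primary_eq_zero_of_classX11b_of_kodairaNeron_rat hW hN hKN3m hKN3a
    (prop37_endBinder_three_of_classX11b hW hN hKN3m hγ)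

/-- **On the class X11b @ 3 ∩ (KN₃)/ℚ: `3^{ord_3 [E(K) : ℤ y_K]} · Ш(E/K)[3^∞] = 0` — modulo the
NAMED fact `GrossLMS1991.prop37_2_reductionCongruence N W K 3`** (the Heegner-INDEX form,
McCallum §1 Theorem in exponent form with Lemma 5.1, for `[E(K) : ℤ P]` finite).  The tree END
`pow_smul_sha_three_primary_eq_zero_of_classX11b_of_kodairaNeron_rat_index`
(`X11b/Three/KolyvaginShaThreeDischarged`) with `hγ` SUPPLIED by §0; binders/conclusion otherwise
VERBATIM.  CONDITIONAL on EXACTLY the named fact {`hγ`} at `3` + `hN` + (KN₃)/ℚ; nothing booked;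
no mark. [cite: McCallumLMS1991, §1 Theorem (Kolyvagin), Lemma 5.1 (p. 303)] [cite: GrossLMS1991, Thm. 1.3 (2), §3 Prop. 3.7 (2) (p. 240)] -/
theorem pow_smul_sha_three_primary_eq_zero_of_classX11b_of_kodairaNeron_rat_index_of_prop37 [NeZero N]
    [W.IsGloballyMinimal] (hW : ClassX11b W 3) (hN : ∀ [W.IsElliptic], N = W.conductorNorm ℤ)
    (hKN3m : ∀ [W.IsElliptic] (v : HeightOneSpectrum (𝓞 ℚ)),
      W.HasMultiplicativeReductionAt v → ¬ 3 ∣ W.ordMinimalDiscriminant v)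
    (hKN3a : ∀ [W.IsElliptic] (v : HeightOneSpectrum (𝓞 ℚ)), W.HasAdditiveReductionAt v →
      W.kodairaSymbolAt v ≠ KodairaSymbol.IV ∧ W.kodairaSymbolAt v ≠ KodairaSymbol.IVstar)
    (hγ : prop37_2_reductionCongruence N W K 3) :
    ∀ [W.IsElliptic] (_hK : IsImaginaryQuadratic K) (_hH : SatisfiesHeegnerHypothesis N K)
      {P : (W.baseChange K).toAffine.Point} (_hP : IsHeegnerPoint N W K P)
      (_hnt : ¬ IsOfFinAddOrder P) (_hidx : (AddSubgroup.zmultiples P).index ≠ 0)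
      (c : (W.baseChange K).sha), (∃ j : ℕ, 3 ^ j • c = 0) →
      3 ^ padicValNat 3 (AddSubgroup.zmultiples P).index • c = 0 :=
  pow_smul_sha_three_primary_eq_zero_of_classX11b_of_kodairaNeron_rat_index hW hN hKN3m hKN3a
    (prop37_endBinder_three_of_classX11b hW hN hKN3m hγ)

/-- **On the class X11b @ 3 ∩ (KN₃)/ℚ: `3 ∤ y_K` in `E(K)` ⟹ `Ш(E/K)[3^∞] = 0`** (Gross 1991
Prop. 2.1 (2) at `p = 3`) — modulo the NAMED fact `GrossLMS1991.prop37_2_reductionCongruence N W K 3`.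
The tree END `sha_three_primary_eq_zero_of_classX11b_of_kodairaNeron_rat_of_not_dvd`
(`X11b/Three/KolyvaginShaThreeDischarged`) with `hγ` SUPPLIED by §0; binders/conclusion otherwise
VERBATIM.  CONDITIONAL on EXACTLY the named fact {`hγ`} at `3` + `hN` + (KN₃)/ℚ; nothing booked;
no mark. [cite: GrossLMS1991, Prop. 2.1 (2), §3 Prop. 3.7 (2) (p. 240), §10] [cite: McCallumLMS1991, §1 Theorem (Kolyvagin)] -/
theorem sha_three_primary_eq_zero_of_classX11b_of_kodairaNeron_rat_of_not_dvd_of_prop37 [NeZero N]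
    [W.IsGloballyMinimal] (hW : ClassX11b W 3) (hN : ∀ [W.IsElliptic], N = W.conductorNorm ℤ)
    (hKN3m : ∀ [W.IsElliptic] (v : HeightOneSpectrum (𝓞 ℚ)),
      W.HasMultiplicativeReductionAt v → ¬ 3 ∣ W.ordMinimalDiscriminant v)
    (hKN3a : ∀ [W.IsElliptic] (v : HeightOneSpectrum (𝓞 ℚ)), W.HasAdditiveReductionAt v →
      W.kodairaSymbolAt v ≠ KodairaSymbol.IV ∧ W.kodairaSymbolAt v ≠ KodairaSymbol.IVstar)
    (hγ : prop37_2_reductionCongruence N W K 3) :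
    ∀ [W.IsElliptic] (_hK : IsImaginaryQuadratic K) (_hH : SatisfiesHeegnerHypothesis N K)
      {P : (W.baseChange K).toAffine.Point} (_hP : IsHeegnerPoint N W K P)
      (_hnt : ¬ IsOfFinAddOrder P)
      (_h3 : ∀ Q : (W.baseChange K).toAffine.Point, 3 • Q ≠ P) (c : (W.baseChange K).sha),
      (∃ j : ℕ, 3 ^ j • c = 0) → c = 0 :=
  sha_three_primary_eq_zero_of_classX11b_of_kodairaNeron_rat_of_not_dvd hW hN hKN3m hKN3a
    (prop37_endBinder_three_of_classX11b hW hN hKN3m hγ)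

end Summit.BirchSwinnertonDyer.Rank1Residual.X11b.Three.KolyvaginDischarged

end
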